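import Summits.ResolutionOfSingularities.ResolutionOfSingularities.Theorems.MarkedTransferCampaignW46TypedProcedureAnchors
import HarnessLib

/-!
# [OURS · L1 W4.6 rung (ii)] THREEFOLD HYPERSURFACES — the regime where MarkedTransfer
# `HypersurfaceOrderReductionDimLeThree` (stmt-ResolutionOfSingularities-16156) applies, and the termination
# shapes of the typed Th. 16.6 procedure there: STATEMENT module (definitions only)

Cell res-hironaka, LADDER-RESOLUTION rung L (D-0089), slot W4.6 «restricted regimes as rungs of the TYPED Th. 16.6
procedure», rung (ii); seat res-L1-s46-pv-3. Host route MarkedTransfer, host item `HypersurfaceOrderReductionDimLeThree`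
(stmt-16156), proposed `--kind definition --supports stmt-ResolutionOfSingularities-16156`.

HONEST FRAMING. Every declaration below is OURS (a campaign definition over the landed shared vocabulary
`Theorems/MarkedTransferCampaignW46TypedProcedure.lean`, namespace `…Theorems.CampaignW46`: `Regime`, `Resume`, `Step`,
`Run`, `DecreaseAlongSteps`, `TerminatesNabla`, …). NOTHING here is a statement of H. Hironaka's manuscript *Resolution
of singularities in positive characteristics* (2017-03-23, [Hironaka2017], lit key `paper:url-3343fd9e678b`) and nothing
here asserts that any statement of it holds; the manuscript enters only through the typed CANDIDATE carriers that the
shared module is built over. No theorem, no `sorry`: the reduction proofs are the companion module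
`MarkedTransferCampaignW46ThreefoldsReduction`. AI review is weaker than expert review.

## OURS versus IMPORTED (what rung (ii) claims, and what it does not)

* IMPORTED AS A REGIME, NOT AS A PREMISE. The host item stmt-16156 is hypersurface order reduction for a regular
  ambient `X` with `topologicalKrullDim X ≤ 3` and an EFFECTIVE CARTIER ideal `I` — an EXISTENTIAL statement («some
  marked resolution exists»; calibration, known case: CJS 2009/2020, Kawanoue–Matsuki). Rung (ii) imports from it ONLY
  ITS BINDERS, read on the state `(A, E)` of the typed procedure at EVERY stage (DESIGN POINT (REG) of the shared
  module): `regimeII := Regime.dimLE 3 ⊓ Regime.cartier` — «`topologicalKrullDim Z ≤ 3`» (16156's `X` is the typed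
  procedure's ambient `Z = A.Z`, smooth irreducible of finite type over `K`, hence regular integral) and
  «`IsEffectiveCartier E.J`» (16156's `I` is the ideal `J` of the current ideal exponent `E = (J, b)`, `b` playing
  16156's `m`; NC-data / boundary are not part of the typed Γ-free procedure, res-L1-ref-b1 / type-o1 21:24:31Z). The
  existence statement 16156 itself is NEVER a hypothesis of a rung-(ii) declaration (SIZED-ASK-L §S: the rung is «the
  TYPED procedure terminates there», a different theorem; `CossartPiltant2019` is calibration only).
* OURS, THE CLAIM SHAPES. (a) `DecreaseII` = the registered one-step shape `DecreaseAlongSteps` (Eq. (127) off `D′` and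
  «`m′ ≤ m`» for every step admitted by the typed centre rule) RESTRICTED to `regimeII` — by the anchor
  `decreaseAlongSteps_of_thm16_6` it is the reading-R instance of the typed candidate `S16Proof.Thm16_6` in this regime;
  (b) `TerminatesNablaII` = the registered «hence terminates» shape `TerminatesNabla` (∇-centred runs, design finding D1)
  restricted to `regimeII`; (c) `TerminatesWholeII` = no infinite run in `regimeII` whose centre at every stage is THE
  WHOLE terminal plat `∇(E_k)` (Th. 16.6 (4) p.84 l.29 «Consider the case in which `D = ∇` and hence `∇′ = ∅`»; the
  sub-family of the ∇-centred runs on which `∇(E_k)` is irreducible at every stage — `TerminatesNabla → TerminatesWhole`,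
  companion module).
* OURS, THE TWO STRUCTURAL HYPOTHESES under which the companion module DERIVES (c) from (a) by a well-founded descent
  of the typed `Inv`-string (kernel-checked reduction, pure logic over the shapes plus the tree's order theory
  `Hironaka2017.InvStringOrder`): `NablaTop` — «the closed points of `∇(E)` are exactly the closed points at which the
  `Inv`-string of the résumé is lexicographically largest, and it is constant there» (the role the terminal plat
  `∇(E) = Sing(𝔜(t))` of Def. 15.11/15.12 p.80 l.29 – p.81 l.4 plays in §16.3 p.87 l.14–24: the stratum the procedure
  attacks is the worst one); `OffCentreLocal` — «at closed points NOT over the centre the `Inv`-string of the résumé of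
  the transform equals the `Inv`-string of the résumé downstairs» (the blow-up is an isomorphism off the centre and
  `Inv_ξ` is a local invariant of the ideal exponent, Eq. (34) p.24; across the RENEWAL of the résumé, §16.3 p.87
  l.17–18 «core-edge focusing is renewed», this is a claim about the intended notion instance, GAP-LEDGER R19, not a
  tautology). Both are stated for a general regime `Rg` and instantiated at `regimeII`; both are explicit HYPOTHESES of
  the reduction theorems, never asserted.
* VACUITY (as (VAC) in the shared module): every Prop below is RELATIVE TO a notion instance `N : Notions n` and a
  reading `Rd`, which the rung's user NAMES (lane-A note res-L1-ref-a2 20:22:12Z; type-o1's `stdNotions`); for an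
  instance without résumés all of them hold vacuously, so no declaration here quantifies over `N`.

## References

* shared module + anchors: `Theorems/MarkedTransferCampaignW46TypedProcedure.lean` (p465445 → v3 p468540),
  `…Anchors.lean` (p465813 → v2 p468263); plan/SIZED-ASK-L.md v0.2 §S S-s46; L/res-L1-s47-dis-1/DISPROOF-LOG.md §D1.
* H. Hironaka, ms. 2017-03-23: Th. 16.6 p.84 l.4–32 (esp. (4) l.29–32); §16.3 p.87 l.10–28; Def. 15.11/15.12 p.80 l.29 –
  p.81 l.4; Eq. (34) p.24 — quoted for scope only, under adjudication, not cited as fact. [Hironaka2017]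
* Route MarkedTransfer, item `HypersurfaceOrderReductionDimLeThree` (stmt-16156): binders `topologicalKrullDim X ≤ 3`,
  `IsEffectiveCartier I` [CossartJannsenSaito2020, KawanoueMatsuki2016] — calibration, not a premise.
-/

noncomputable section

set_option linter.dupNamespace false -- mandated namespace of this single-conjunct summit

open CategoryTheory AlgebraicGeometry TopologicalSpace

namespace Summit.ResolutionOfSingularities.ResolutionOfSingularities.Theorems

namespace CampaignW46

open Literature.AlgebraicGeometry.Resolution
open Literature.AlgebraicGeometry.Hironaka2017.S02Preliminaries
open Literature.AlgebraicGeometry.Hironaka2017.Datum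
open Literature.AlgebraicGeometry.Hironaka2017.S15ARSchemes
open Literature.AlgebraicGeometry.Hironaka2017.S16Proof

universe u

variable {n : ℕ} {p : ℕ} [Fact p.Prime] {K : Type u} [Field K] [CharP K p]

/-! ## The regime of rung (ii): the binders of stmt-16156 read on the state -/

/-- [OURS · L1 W4.6 rung (ii)] replaces the role of «the case of hypersurfaces in a threefold» among the restricted regimes
of RESCUE-SEED W4.6; NOT a statement of the manuscript. THE REGIME WHERE `HypersurfaceOrderReductionDimLeThree`
(stmt-16156) APPLIES, read on the state `(A, E)` of the typed procedure and imposed at EVERY stage: the ambient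
`Z = A.Z` has `topologicalKrullDim Z ≤ 3` (16156's «`topologicalKrullDim X ≤ 3`»; `Regime.dimLE 3`) AND the ideal `J` of
`E = (J, b)` is effective Cartier (16156's «`IsEffectiveCartier I`»; `Regime.cartier`) — i.e. `E` is a hypersurface
exponent in an ambient threefold (surface, curve or point loci embedded in a regular threefold). The remaining binders of
16156 (`X` regular integral separated of finite type over a perfect field, `I ≠ ⊥`, `1 ≤ m`) are the standing ambient /
standard-exponent conditions of the typed procedure; its CONCLUSION (existence of a marked resolution) is not used
anywhere. [folklore] -/
def regimeII : Regime p K :=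
  Regime.inter (Regime.dimLE 3) Regime.cartier

/-- [OURS] unfolding of `regimeII`: a state is in regime (ii) iff `topologicalKrullDim Z ≤ 3` and `E.J` is effective
Cartier. [folklore] -/
theorem regimeII_iff (A : AmbientDatum p K) (E : IdealExponent A.Z) :
    regimeII A E ↔ topologicalKrullDim A.Z ≤ (3 : ℕ) ∧ IsEffectiveCartier E.J :=
  Iff.rfl

/-! ## Structural hypothesis shapes (general regime) -/

/-- [OURS · L1 W4.6] replaces the role of «the terminal plat `∇(E) = Sing(𝔜(t))` is the stratum of worst points»
(Def. 15.11/15.12 p.80 l.29 – p.81 l.4 with Eq. (126); §16.3 p.87 l.14–24) as a HYPOTHESIS SHAPE on the notion instance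
`N` read by `Rd`, restricted to the regime `Rg`; NOT a statement of the manuscript. For every state `(A, E)` in `Rg` and
every résumé `R` of `E` read by `Rd`: there is a CLOSED point `η ∈ ∇(E)` such that (T1) every closed point of `∇(E)` has
the same typed `Inv`-string as `η` (`Resume.invStr`, Eq. (127) p.84 l.11–16) and (T2) every closed point of `Z` outside
`∇(E)` has a strictly SMALLER `Inv`-string in the 0-padded order `InvString.LexLT` (p.84 l.17–20). Never asserted; a
hypothesis of the companion module's reduction. [folklore] -/
def NablaTop (N : Notions.{u} n) (Rd : Reading p K N) (Rg : Regime p K) : Prop :=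
  ∀ (A : AmbientDatum p K) (E : IdealExponent A.Z) (R : Resume N A E), Rg A E → Rd A E R →
    ∃ η : A.Z, η ∈ (R.nabla : Set A.Z) ∧ η ∈ Literature.AlgebraicGeometry.Hironaka2017.S02Preliminaries.closedPoints A.Z ∧
      (∀ ξ : A.Z, ξ ∈ Literature.AlgebraicGeometry.Hironaka2017.S02Preliminaries.closedPoints A.Z → ξ ∈ (R.nabla : Set A.Z) →
        R.invStr ξ = R.invStr η) ∧
      (∀ ξ : A.Z, ξ ∈ Literature.AlgebraicGeometry.Hironaka2017.S02Preliminaries.closedPoints A.Z → ξ ∉ (R.nabla : Set A.Z) →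
        InvString.LexLT (R.invStr ξ) (R.invStr η))

/-- [OURS · L1 W4.6] replaces the role of «a blow-up changes nothing away from its centre» for the typed `Inv`-strings
ACROSS THE RENEWAL of the résumé (the blow-up `π` is an isomorphism over `Z ∖ D`; `Inv_ξ` of Eq. (34) p.24 is a local
invariant of the ideal exponent; §16.3 p.87 l.17–18 «core-edge focusing is renewed … after each sequence of blowups») as
a HYPOTHESIS SHAPE on `N`/`Rd` restricted to `Rg`; NOT a statement of the manuscript. For every state `(A, E)` in `Rg`
with résumé `R` read by `Rd`, every step `s` admitted by the typed centre rule, and every résumé `R′` of the transform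
`E′` read by `Rd`: at every CLOSED point `ξ′` of `Z′` with `π ξ′ ∉ D` the `Inv`-string of `R′` at `ξ′` equals the
`Inv`-string of `R` at `π ξ′`. Never asserted; a hypothesis of the companion module's reduction. [folklore] -/
def OffCentreLocal (N : Notions.{u} n) (Rd : Reading p K N) (Rg : Regime p K) : Prop :=
  ∀ (A : AmbientDatum p K) (E : IdealExponent A.Z) (R : Resume N A E), Rg A E → Rd A E R →
    ∀ (A' : AmbientDatum p K) (s : Step R A') (R' : Resume N A' s.E'), Rd A' s.E' R' →
      ∀ ξ' : A'.Z, ξ' ∈ Literature.AlgebraicGeometry.Hironaka2017.S02Preliminaries.closedPoints A'.Z → s.π ξ' ∉ (s.D : Set A.Z) →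
        R'.invStr ξ' = R.invStr (s.π ξ')

/-! ## Whole-∇ runs («the case `D = ∇`», Th. 16.6 (4)) and their termination shape -/

/-- [OURS · L1 W4.6] replaces the role of «the case in which `D = ∇`» (Th. 16.6 (4) p.84 l.29; «∇ blowups», §16.2 title
p.84 l.2; Rem. 16.2 (2) p.81 l.23–25) as a predicate on runs of the typed procedure; NOT a statement of the manuscript.
A run is WHOLE if at every stage its centre is the entire terminal plat `∇(E_k)` (as sets) — the literal rule then makes
`∇(E_k)` irreducible, and a whole run is in particular a ∇-centred run (`RunNabla`: the centre is the unique irreducible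
component of `∇(E_k)`; companion module `Run.IsWhole.isNablaComponent`). [folklore] -/
def Run.IsWhole {N : Notions.{u} n} {Rd : Reading p K N} (r : Run N Rd) : Prop :=
  ∀ k, ((r.step k).D : Set (r.A k).Z) = ((r.R k).nabla : Set (r.A k).Z)

/-- [OURS · L1 W4.6] «HENCE TERMINATES» FOR WHOLE-∇ RUNS, restricted to the regime `Rg` — replaces the role of the
termination half of Th. 16.13 p.87 l.26–28 («repeatedly but finitely many times») for the sub-family of runs of
Th. 16.6 (4)'s case `D = ∇`: there is NO infinite run all of whose stages lie in `Rg` and all of whose centres are the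
whole current terminal plat. NOT a statement of the manuscript. Weaker than `TerminatesNabla N Rd Rg` (companion
module `terminatesWhole_of_terminatesNabla`); VACUITY as (VAC) in the shared module — users NAME `N`. [folklore] -/
def TerminatesWhole (N : Notions.{u} n) (Rd : Reading p K N) (Rg : Regime p K) : Prop :=
  ∀ r : Run N Rd, r.IsWhole → (∀ k, Rg (r.A k) (r.E k)) → False

/-! ## Rung (ii): the named instances at `regimeII` -/

/-- [OURS · L1 W4.6 rung (ii)] `Campaign.Thm16_6_2_ours_(ii)` — replaces the role of Th. 16.6 (2) / Eq. (127) p.84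
l.10–20 («and `m′ ≤ m`») RESTRICTED to threefold hypersurface states: the registered one-step shape `DecreaseAlongSteps`
at `regimeII`, relative to the NAMED notion instance `N` and reading `Rd`. By the anchor `decreaseAlongSteps_of_thm16_6`
it is implied by the typed candidate `S16Proof.Thm16_6 n (primeR N Rd) _` (reading R); NOT a statement of the
manuscript and not asserted. [folklore] -/
def DecreaseII (N : Notions.{u} n) (Rd : Reading p K N) : Prop :=
  DecreaseAlongSteps N Rd regimeII

/-- [OURS · L1 W4.6 rung (ii)] the hypothesis shape `NablaTop` at `regimeII` (threefold hypersurface states), relative to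
the named `N`, `Rd`. Not asserted. [folklore] -/
def NablaTopII (N : Notions.{u} n) (Rd : Reading p K N) : Prop :=
  NablaTop N Rd regimeII

/-- [OURS · L1 W4.6 rung (ii)] the hypothesis shape `OffCentreLocal` at `regimeII` (threefold hypersurface states),
relative to the named `N`, `Rd`. Not asserted. [folklore] -/
def OffCentreLocalII (N : Notions.{u} n) (Rd : Reading p K N) : Prop :=
  OffCentreLocal N Rd regimeII

/-- [OURS · L1 W4.6 rung (ii)] `Campaign.Thm16_13_ours_(ii), whole-∇ form` — replaces the role of «hence terminates»
(Th. 16.13 p.87 l.26–28) for the typed procedure run with centre = the whole terminal plat (Th. 16.6 (4) p.84 l.29),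
RESTRICTED to threefold hypersurface states (`regimeII` at every stage), relative to the NAMED `N`, `Rd`: `TerminatesWhole N
Rd regimeII`. This is the rung-(ii) statement the companion module PROVES from `DecreaseII ∧ NablaTopII ∧
OffCentreLocalII` (`terminatesWholeII_of_decrease`). NOT a statement of the manuscript. [folklore] -/
def TerminatesWholeII (N : Notions.{u} n) (Rd : Reading p K N) : Prop :=
  TerminatesWhole N Rd regimeII

/-- [OURS · L1 W4.6 rung (ii)] `Campaign.Thm16_13_ours_(ii), ∇-centred form` — the registered «hence terminates» shape
`TerminatesNabla` (design finding D1: centres = irreducible COMPONENTS of `∇(E_k)`) RESTRICTED to threefold hypersurface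
states, relative to the NAMED `N`, `Rd`. It implies `TerminatesWholeII N Rd` (companion module); the converse step — runs
through REDUCIBLE terminal plats, where a proper component is blown up and the top `Inv`-string need not drop — is NOT
closed by the companion module and needs, besides `DecreaseII`/`NablaTopII`/`OffCentreLocalII`, the Eq. (128)-shape on
`D′` (typed `S16Proof.Thm16_6_3`) and a component count of `∇` (recorded there as the open sub-goal). NOT a statement of
the manuscript. [folklore] -/
def TerminatesNablaII (N : Notions.{u} n) (Rd : Reading p K N) : Prop :=
  TerminatesNabla N Rd regimeII

/-! ## Shapes for the COMPONENT-WISE form (appended 2026-08-26 by res-L1-s46-pv-3, append-only): Eq. (128) along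
steps and monotone numbers of stops — the two further hypotheses under which the companion module
`MarkedTransferCampaignW46ThreefoldsComponents` derives the registered ∇-centred rung `TerminatesNabla` (centres =
irreducible COMPONENTS of `∇(E_k)`, design finding D1) from the one-step shapes, counting the components of the
terminal plat through strict transforms (tree: de Jong 1996, 4.27, `Resolution.componentsIn`). -/

section ComponentShapes

variable {N : Notions.{u} n} {A A' : AmbientDatum p K} {E : IdealExponent A.Z} {R : Resume N A E}

/-- Eq. (128) FOR THE STEP `s`, reading R — the consequence-shape of Th. 16.6 (3) p.84 l.21–28 («for every closed point
`η′` of the strict transform `∇′` of `∇` … the equality (128)», both strings of length `m`): for a résumé `R′` of the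
transform `E′` on `A′`, LITERALLY row 019's `Thm16_6_3 R.mti s.π s.D (fun _ => R'.mti)` (companion of the shared
module's `Step.Decrease` = the (2)-part). OURS instantiation; NOT a statement of the manuscript and not asserted; it
carries the claim tag only because its content is the consequence-shape of a claim under review.
[claim: Hironaka2017, status: under-review] -/
def Step.Equality (s : Step R A') (R' : Resume N A' s.E') : Prop :=
  Thm16_6_3 R.mti s.π s.D (fun _ => R'.mti)

end ComponentShapes

/-- [OURS · L1 W4.6] replaces the role of Th. 16.6 (3) / Eq. (128) p.84 l.21–28 RESTRICTED to a regime, as a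
HYPOTHESIS SHAPE (the (3)-companion of `DecreaseAlongSteps`): for every state `(A, E, R)` in `Rg` read by `Rd`, every
step `s` admitted by the typed centre rule and every résumé `R′` of the transform read by `Rd`, Eq. (128) holds at the
closed points of the strict transform `∇′` (`Step.Equality`). By the companion module's anchor
`equalityAlongSteps_of_thm16_6` it is implied by the typed candidate `S16Proof.Thm16_6 n (primeR N Rd) _`; NOT a
statement of the manuscript and never asserted. [folklore] -/
def EqualityAlongSteps (N : Notions.{u} n) (Rd : Reading p K N) (Rg : Regime p K) : Prop :=
  ∀ (A : AmbientDatum p K) (E : IdealExponent A.Z) (R : Resume N A E), Rg A E → Rd A E R →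
    ∀ (A' : AmbientDatum p K) (s : Step R A') (R' : Resume N A' s.E'), Rd A' s.E' R' → s.Equality R'

/-- [OURS · L1 W4.6] replaces the role of «the actual number `m` of stops before reaching the terminal may (or may not)
drop …, that is to say `m′ ≤ m`» (Th. 16.6 (2) p.84 l.17–18) read for the WHOLE step — at every point, in particular
on `D′ = ∇′ ∩ π⁻¹(D)` where the typed `Thm16_6_2_mle` is silent — as a HYPOTHESIS SHAPE restricted to the regime `Rg`:
for every state in `Rg` read by `Rd`, every admitted step and every résumé `R′` of the transform read by `Rd`,
`R′.m ≤ R.m`. NOT a statement of the manuscript; never asserted. [folklore] -/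
def StopsMonotone (N : Notions.{u} n) (Rd : Reading p K N) (Rg : Regime p K) : Prop :=
  ∀ (A : AmbientDatum p K) (E : IdealExponent A.Z) (R : Resume N A E), Rg A E → Rd A E R →
    ∀ (A' : AmbientDatum p K) (s : Step R A') (R' : Resume N A' s.E'), Rd A' s.E' R' → R'.m ≤ R.m

/-- [OURS · L1 W4.6 rung (ii)] the hypothesis shape `EqualityAlongSteps` (Eq. (128) on `∇′`) at `regimeII` (threefold
hypersurface states), relative to the named `N`, `Rd`. Not asserted. [folklore] -/
def EqualityII (N : Notions.{u} n) (Rd : Reading p K N) : Prop :=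
  EqualityAlongSteps N Rd regimeII

/-- [OURS · L1 W4.6 rung (ii)] the hypothesis shape `StopsMonotone` (`m′ ≤ m` along every step) at `regimeII`
(threefold hypersurface states), relative to the named `N`, `Rd`. Not asserted. [folklore] -/
def StopsMonotoneII (N : Notions.{u} n) (Rd : Reading p K N) : Prop :=
  StopsMonotone N Rd regimeII

/-! ## The SINGULAR-LOCUS form of the top-stratum hypothesis (appended 2026-08-27 by res-L1-s46-pv-3, append-only):
(T2) is asked only at closed points of `Sing(E) ∖ ∇(E)` — the value of the reading's `Inv` outside `Sing(E)` (where
Eq. (34) p.24 does not define `Inv_ξ`) is never consulted. The companion module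
`MarkedTransferCampaignW46ThreefoldsSingular` re-derives both reductions from this weaker shape, transporting orders
off the centre by the tree's `IsBlowup.idealOrder_controlledTransform_eq_of_not_mem_support` (CoP 2008 Prop. 4.2). -/

/-- [OURS · L1 W4.6] the SINGULAR-LOCUS form of `NablaTop` — replaces the role of «the terminal plat `∇(E)` is the
stratum of worst points OF `Sing(E)`» (Def. 15.11/15.12 p.80 l.29 – p.81 l.4; `Inv_ξ` is defined for singular points,
Eq. (34) p.24) as a HYPOTHESIS SHAPE restricted to the regime `Rg`; NOT a statement of the manuscript. For every state
`(A, E)` in `Rg` and every résumé `R` of `E` read by `Rd`: there is a CLOSED point `η ∈ ∇(E)` such that (T1) every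
closed point of `∇(E)` has the same typed `Inv`-string as `η` and (T2-Sing) every closed point of `Sing(E)` outside
`∇(E)` has a strictly smaller one (`InvString.LexLT`). Weaker than `NablaTop N Rd Rg` (companion module
`nablaTopSing_of_nablaTop`). Never asserted. [folklore] -/
def NablaTopSing (N : Notions.{u} n) (Rd : Reading p K N) (Rg : Regime p K) : Prop :=
  ∀ (A : AmbientDatum p K) (E : IdealExponent A.Z) (R : Resume N A E), Rg A E → Rd A E R →
    ∃ η : A.Z, η ∈ (R.nabla : Set A.Z) ∧ η ∈ Literature.AlgebraicGeometry.Hironaka2017.S02Preliminaries.closedPoints A.Z ∧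
      (∀ ξ : A.Z, ξ ∈ Literature.AlgebraicGeometry.Hironaka2017.S02Preliminaries.closedPoints A.Z →
        ξ ∈ (R.nabla : Set A.Z) → R.invStr ξ = R.invStr η) ∧
      (∀ ξ : A.Z, ξ ∈ Literature.AlgebraicGeometry.Hironaka2017.S02Preliminaries.closedPoints A.Z →
        ξ ∈ E.sing → ξ ∉ (R.nabla : Set A.Z) → InvString.LexLT (R.invStr ξ) (R.invStr η))

/-- [OURS · L1 W4.6 rung (ii)] the singular-locus top-stratum shape `NablaTopSing` at `regimeII` (threefold hypersurface
states), relative to the named `N`, `Rd`. Not asserted. [folklore] -/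
def NablaTopSingII (N : Notions.{u} n) (Rd : Reading p K N) : Prop :=
  NablaTopSing N Rd regimeII

/-! ## The 0-PADDED and the MONOTONE off-centre shapes (appended 2026-08-27 by res-L1-s46-pv-3, append-only), on the
concordant finding of OURS-DESK #38 (lane A res-L1-ref-a3 00:40:02Z, lane B res-L1-ref-b1 00:42:49Z): `OffCentreLocal`
compares the strings by LIST equality and thereby forces `m′ = m` at every admitted step with a closed point off the
centre — STRONGER than the printed role (Eq. (34) p.24 locality; «`m′ ≤ m` … extend the sequences by adding (0)
repeatedly» p.84 l.17–20; «with some deletions of those with Sing emptied … the chain is made shorter and shorter» §16.3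
p.87 l.16–23). Two weaker shapes are recorded. (1) `OffCentreLocalPad` — the lanes' one-line diff verbatim: equality of
the 0-padded entries `InvString.padKey _ j` for every `j` (all that `InvString.LexLT` consults). HONEST NOTE: for
`n ≥ 1` every genuine entry has a key strictly above the padding key (tree `InvStringOrder.zero_lt_key`), so padded
equality still forces equal LENGTHS — it is only nominally weaker than `OffCentreLocal` (companion module
`MarkedTransferCampaignW46ThreefoldsPadded`, `length_eq_of_padKey_eq`). (2) `OffCentreMonotone` — the string does NOT GO
UP off the centre in the 0-padded order (`¬ LexLT (string below) (string above)`): strictly weaker, compatible with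
`m′ < m` (a truncated string compares `≤` its original, the padding key lying below every entry), and — together with
`StopsMonotone` for the lengths — still sufficient for the whole-∇ reduction (companion module). `OffCentreLocal →
OffCentreLocalPad → OffCentreMonotone`; the old shape stays on record as the explicitly STRONGER variant. -/

/-- [OURS · L1 W4.6] replaces the role of «a blow-up changes nothing away from its centre» for the typed `Inv`-strings
ACROSS THE RENEWAL of the résumé (Eq. (34) p.24 locality of `Inv_ξ`; §16.3 p.87 l.17–18 «core-edge focusing is
renewed»), 0-PADDED FORM («extend the sequences by adding (0) repeatedly», p.84 l.19–20), as a HYPOTHESIS SHAPE on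
`N`/`Rd` restricted to `Rg`; NOT a statement of the manuscript. For every state `(A, E)` in `Rg` with résumé `R` read by
`Rd`, every admitted step `s`, every résumé `R′` of the transform read by `Rd`, and every CLOSED point `ξ′` of `Z′` with
`π ξ′ ∉ D`: the `Inv`-strings of `R′` at `ξ′` and of `R` at `π ξ′` have the same 0-padded `j`-th entry
(`InvString.padKey`) for every `j` — so they compare identically under `InvString.LexLT` against every string. Nominally
weaker than `OffCentreLocal` (see the section note: for `n ≥ 1` it still forces equal lengths). Never asserted.
[folklore] -/
def OffCentreLocalPad (N : Notions.{u} n) (Rd : Reading p K N) (Rg : Regime p K) : Prop :=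
  ∀ (A : AmbientDatum p K) (E : IdealExponent A.Z) (R : Resume N A E), Rg A E → Rd A E R →
    ∀ (A' : AmbientDatum p K) (s : Step R A') (R' : Resume N A' s.E'), Rd A' s.E' R' →
      ∀ ξ' : A'.Z, ξ' ∈ Literature.AlgebraicGeometry.Hironaka2017.S02Preliminaries.closedPoints A'.Z → s.π ξ' ∉ (s.D : Set A.Z) →
        ∀ j : ℕ, InvString.padKey (R'.invStr ξ') j = InvString.padKey (R.invStr (s.π ξ')) j

/-- [OURS · L1 W4.6] replaces the role of «a blow-up changes nothing away from its centre — in particular nothing gets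
WORSE there» for the typed `Inv`-strings across the renewal of the résumé (Eq. (34) p.24; «`m′ ≤ m` … adding (0)
repeatedly» p.84 l.17–20; «deletions of those with Sing emptied» §16.3 p.87 l.16–17), MONOTONE FORM, as a HYPOTHESIS
SHAPE on `N`/`Rd` restricted to `Rg`; NOT a statement of the manuscript. For every state `(A, E)` in `Rg` with résumé `R`
read by `Rd`, every admitted step `s`, every résumé `R′` of the transform read by `Rd`, and every CLOSED point `ξ′` of
`Z′` with `π ξ′ ∉ D`: the `Inv`-string of `R′` at `ξ′` is NOT strictly above the `Inv`-string of `R` at `π ξ′` in the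
0-padded order (`¬ InvString.LexLT (R.invStr (π ξ′)) (R′.invStr ξ′)`). Strictly weaker than `OffCentreLocalPad`
(compatible with a truncated string, `m′ < m`); the lengths are controlled separately by `StopsMonotone`. Never
asserted. [folklore] -/
def OffCentreMonotone (N : Notions.{u} n) (Rd : Reading p K N) (Rg : Regime p K) : Prop :=
  ∀ (A : AmbientDatum p K) (E : IdealExponent A.Z) (R : Resume N A E), Rg A E → Rd A E R →
    ∀ (A' : AmbientDatum p K) (s : Step R A') (R' : Resume N A' s.E'), Rd A' s.E' R' →
      ∀ ξ' : A'.Z, ξ' ∈ Literature.AlgebraicGeometry.Hironaka2017.S02Preliminaries.closedPoints A'.Z → s.π ξ' ∉ (s.D : Set A.Z) →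
        ¬ InvString.LexLT (R.invStr (s.π ξ')) (R'.invStr ξ')

/-- [OURS · L1 W4.6 rung (ii)] the 0-padded off-centre shape `OffCentreLocalPad` at `regimeII` (threefold hypersurface
states), relative to the named `N`, `Rd` — the faithful form of `OffCentreLocalII` asked for by OURS-DESK #38 (to be
used together with `StopsMonotoneII`). Not asserted. [folklore] -/
def OffCentreLocalPadII (N : Notions.{u} n) (Rd : Reading p K N) : Prop :=
  OffCentreLocalPad N Rd regimeII

/-- [OURS · L1 W4.6 rung (ii)] the monotone off-centre shape `OffCentreMonotone` at `regimeII` (threefold hypersurface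
states), relative to the named `N`, `Rd`. Not asserted. [folklore] -/
def OffCentreMonotoneII (N : Notions.{u} n) (Rd : Reading p K N) : Prop :=
  OffCentreMonotone N Rd regimeII

/-! ## Reading (M⁺) twins of the claim-shaped decls (appended 2026-08-27 by res-L1-s46-pv-3, append-only), after the shared
module's v4 §«Reading sibling (M⁺)» (res-L1-type-o1, p479675: `Resume.mSucc := t + 1`, `Resume.mtiSucc`, `Step.DecreaseSucc`,
`DecreaseAlongStepsSucc`, `primeRSucc`) and its invitation «your Eq. (128) twin `Step.EqualitySucc` is one line in
Threefolds.lean over `R.mtiSucc`» (STATUS 2026-08-27T00:53:30Z). WHY: under (M) `m := t` the one-step shape `DecreaseII`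
inherits the `t = 0` edge (Eq. (127) against the empty string is unsatisfiable — res-L1-s46-pv-7 p471737), so for notion
instances with `t = 0` résumés in regime (ii) the rung is vacuous; under (M⁺) the edge is absent. The STRUCTURAL hypothesis
shapes (top stratum, off-centre monotonicity, `m′ ≤ m`) are stated reading-generically in the companion module
`MarkedTransferCampaignW46StringReading` (`StringReading.TopSingShape` / `MonotoneShape` / `StopsShape` at `readingMSucc`);
the reductions for every reading are `MarkedTransferCampaignW46StringReadingReduction`, the (M⁺) rung (ii) assembly is
`MarkedTransferCampaignW46ThreefoldsSucc`. Neither reading is preferred here. -/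

section EqualitySucc

variable {N : Notions.{u} n} {A A' : AmbientDatum p K} {E : IdealExponent A.Z} {R : Resume N A E}

/-- Eq. (128) FOR THE STEP `s`, reading R, UNDER (M⁺) — twin of `Step.Equality`: the consequence-shape of Th. 16.6 (3)
p.84 l.21–28 with «the actual number `m` of stops» read as `t + 1` (both strings of length `t + 1`, terminal stage
included): LITERALLY row 019's `Thm16_6_3 R.mtiSucc s.π s.D (fun _ => R'.mtiSucc)`. OURS instantiation; NOT a statement
of the manuscript and not asserted; claim tag because its content is the consequence-shape of a claim under review.
[claim: Hironaka2017, status: under-review] -/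
def Step.EqualitySucc (s : Step R A') (R' : Resume N A' s.E') : Prop :=
  Thm16_6_3 R.mtiSucc s.π s.D (fun _ => R'.mtiSucc)

end EqualitySucc

/-- [OURS · L1 W4.6] replaces the role of Th. 16.6 (3) / Eq. (128) p.84 l.21–28 RESTRICTED to a regime, READ WITH
`m := t + 1` (reading (M⁺)), as a HYPOTHESIS SHAPE — twin of `EqualityAlongSteps` with `Step.EqualitySucc`: for every state
`(A, E, R)` in `Rg` read by `Rd`, every admitted step `s` and every résumé `R′` of the transform read by `Rd`, Eq. (128)
(strings of length `t + 1`) holds at the closed points of the strict transform `∇′`. By the anchor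
`equalityAlongStepsSucc_of_thm16_6` (companion module `…ThreefoldsSucc`) it is implied by the typed candidate
`S16Proof.Thm16_6 n (primeRSucc N Rd) _`; NOT a statement of the manuscript and never asserted. [folklore] -/
def EqualityAlongStepsSucc (N : Notions.{u} n) (Rd : Reading p K N) (Rg : Regime p K) : Prop :=
  ∀ (A : AmbientDatum p K) (E : IdealExponent A.Z) (R : Resume N A E), Rg A E → Rd A E R →
    ∀ (A' : AmbientDatum p K) (s : Step R A') (R' : Resume N A' s.E'), Rd A' s.E' R' → s.EqualitySucc R'

/-- [OURS · L1 W4.6 rung (ii)] `Campaign.Thm16_6_2_ours_(ii)` UNDER READING (M⁺) — twin of `DecreaseII`: the shared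
module's (M⁺) one-step shape `DecreaseAlongStepsSucc` (Eq. (127) with strings of length `t + 1`, `t′ + 1` off `D′`, and
`m′ ≤ m`) RESTRICTED to threefold hypersurface states, relative to the NAMED `N`, `Rd`. By the shared anchor
`decreaseAlongStepsSucc_of_thm16_6` it is implied by `S16Proof.Thm16_6 n (primeRSucc N Rd) _`. Free of the `t = 0` edge of
`DecreaseII`. NOT a statement of the manuscript and not asserted. [folklore] -/
def DecreaseIISucc (N : Notions.{u} n) (Rd : Reading p K N) : Prop :=
  DecreaseAlongStepsSucc N Rd regimeII

/-- [OURS · L1 W4.6 rung (ii)] the (M⁺) Eq. (128)-shape `EqualityAlongStepsSucc` at `regimeII` (threefold hypersurface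
states), relative to the named `N`, `Rd` — twin of `EqualityII`. Not asserted. [folklore] -/
def EqualityIISucc (N : Notions.{u} n) (Rd : Reading p K N) : Prop :=
  EqualityAlongStepsSucc N Rd regimeII

end CampaignW46

end Summit.ResolutionOfSingularities.ResolutionOfSingularities.Theorems

end
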